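import Literature.Computability.Cryptography.HallgrenCombCorrMass
import Literature.Computability.Cryptography.PeriodFindingTwoSamples
import HarnessLib

/-!
# Hallgren's period finding in the tree's family: the per-unit probability of a harmonic

Topic `Computability/Cryptography`; joins `HallgrenCombCorrMass.lean` (the autocorrelation mass of a
blurred gap table at the harmonics `kQ/S` of its pitch) to `PeriodFindingTwoSamples.lean`
(`prob_cEst_ge`: Kitaev's estimate of a unit hits a character `c` with probability
`≥ (1 − ηacc) · unitWeight_u (c)`). If the table `F u` read by unit `u` has, on `[0, Q_u)`, the
level sets of a blurred gap table `T` (any injective re-coding of its values, e.g. the answer tuples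
of the table-bit oracle, `PeriodFindingTableOracle.FuI_tabLang_inj`), then for every harmonic
`k ≤ S/(30(2w+1))` the estimate of unit `u` is the rounded harmonic `c_k = round(kQ/S)` with
probability `≥ (1 − ηacc) · #goodStarts · ((⌊Q/S⌋ − 1)/12)² / Q²` (`prob_cEst_harmonic_ge`); and the
rounded harmonics are injective in `k` (`round_harmonic_injOn`, pitch `Q/S ≥ 5`), as
`prob_twoSamples_ge` requires. Theorem file, no named facts.

## References

* R. Jozsa, arXiv:quant-ph/0302134 (2003), §10 (Thm. 6: "prob(c_k) ≥ …", eqs. (j1)–(j2)). [Jozsa2003]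
* A. Yu. Kitaev, arXiv:quant-ph/9511026 (1995), §3. [Kitaev1995]
-/

noncomputable section

open scoped Classical

namespace Literature.Computability.Cryptography

namespace PeriodFinding

open Finset BlurredGapTable

variable {U : Type*} [Fintype U] [DecidableEq U] {Ω : Type*} [DecidableEq Ω] {Lv Bk : ℕ} {α : Type*}

omit [Fintype U] [DecidableEq U] in
/-- **The unit weight of a harmonic** for a unit reading (a re-coding of) a blurred gap table:
`unitWeight_u (c) ≥ #goodStarts ((⌊Q/S⌋ − 1)/12)² / Q²` at `c` within `1/2` of `kQ/S`.
[cite: Jozsa2003, §10 Thm. 6] -/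
theorem unitWeight_harmonic_ge (Lu : U → ℕ) (F : U → ℕ → Ω) (T : BlurredGapTable α) {u : U} {k : ℕ} {c : ℕ}
    (hrel : ∀ v < Qof Lu u, ∀ v' < Qof Lu u, (F u v = F u v' ↔ T.FN v = T.FN v'))
    (hS : 1 ≤ T.S) (hQ : 100 * (2 * T.w + 1) ≤ Qof Lu u) (hQS : 5 * T.S + 5 * (2 * T.w + 1) ≤ Qof Lu u)
    (hk : 30 * (k : ℝ) * (2 * T.w + 1) ≤ T.S) (hc : |(c : ℝ) - k * (Qof Lu u) / T.S| ≤ 1 / 2) :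
    (T.goodStarts.card : ℝ) * (((⌊(Qof Lu u : ℝ) / T.S⌋₊ - 1 : ℕ) : ℝ) / 12) ^ 2 / ((Qof Lu u : ℝ) ^ 2) ≤
      unitWeight Lu F u c := by
  unfold unitWeight
  rw [corrMass_congr_rel hrel]
  refine div_le_div_of_nonneg_right ?_ (by positivity)
  have := T.corrMass_harmonic_ge (Q := Qof Lu u) (k := k) (c := (c : ℤ)) hS hQ hQS hk (by exact_mod_cast hc)
  exact_mod_cast this

/-- **The probability of a harmonic**: Kitaev's estimate of unit `u` is the character `c` (within
`1/2` of `kQ/S`) with probability `≥ (1 − ηacc) #goodStarts ((⌊Q/S⌋−1)/12)² / Q²`.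
[cite: Jozsa2003, §10 Thm. 6] [cite: Kitaev1995, §3] -/
theorem prob_cEst_harmonic_ge (Lu : U → ℕ) (F : U → ℕ → Ω) (T : BlurredGapTable α) (hB : 0 < Bk) (hLv : 0 < Lv)
    {u : U} (hQLv : Qof Lu u ≤ 2 ^ (Lv - 1)) {k c : ℕ} (hcQ : c < Qof Lu u)
    (hrel : ∀ v < Qof Lu u, ∀ v' < Qof Lu u, (F u v = F u v' ↔ T.FN v = T.FN v'))
    (hS : 1 ≤ T.S) (hQ : 100 * (2 * T.w + 1) ≤ Qof Lu u) (hQS : 5 * T.S + 5 * (2 * T.w + 1) ≤ Qof Lu u)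
    (hk : 30 * (k : ℝ) * (2 * T.w + 1) ≤ T.S) (hc : |(c : ℝ) - k * (Qof Lu u) / T.S| ≤ 1 / 2)
    (hη : 0 ≤ 1 - ηacc Lv Bk) :
    (1 - ηacc Lv Bk) * ((T.goodStarts.card : ℝ) * (((⌊(Qof Lu u : ℝ) / T.S⌋₊ - 1 : ℕ) : ℝ) / 12) ^ 2 /
        ((Qof Lu u : ℝ) ^ 2)) ≤
      prob (X := fun _ : U => TIdx Lv Bk → Bool) (unitLaw Lu F) (univ.filter fun γ => cEst (Qof Lu u) (γ u) = c) := by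
  have h1 := prob_cEst_ge (Lv := Lv) (B := Bk) Lu F hB hLv hQLv ⟨c, hcQ⟩
  have h2 := unitWeight_harmonic_ge Lu F T hrel hS hQ hQS hk hc
  exact (mul_le_mul_of_nonneg_left h2 hη).trans h1

/-- **Rounded harmonics are injective** when the pitch `Q/S` is at least `2`: `round(kQ/S)` determines
`k`. [cite: Jozsa2003, §10 (the multiples kq/S are q/S ≥ 3S apart)] -/
theorem round_harmonic_injective {Q : ℕ} {S : ℝ} (hS : 0 < S) (hQS : 2 * S ≤ Q) :
    Function.Injective fun k : ℕ => round ((k : ℝ) * Q / S) := by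
  intro k k' h
  simp only at h
  by_contra hne
  have hQS' : (2 : ℝ) ≤ Q / S := by rw [le_div_iff₀ hS]; linarith
  have hQSpos : (0 : ℝ) < Q / S := by linarith
  have hgap : (1 : ℝ) * (Q / S) ≤ |(k : ℝ) * Q / S - k' * Q / S| := by
    rw [show (k : ℝ) * Q / S - k' * Q / S = ((k : ℝ) - k') * (Q / S) by ring, abs_mul,
      abs_of_pos hQSpos]
    refine mul_le_mul_of_nonneg_right ?_ hQSpos.le
    have : (1 : ℤ) ≤ |(k : ℤ) - k'| := by
      have : (k : ℤ) ≠ k' := by exact_mod_cast hne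
      have := abs_pos.mpr (sub_ne_zero.mpr this); omega
    have : ((1 : ℤ) : ℝ) ≤ ((|(k : ℤ) - k'| : ℤ) : ℝ) := by exact_mod_cast this
    simpa using this
  have r1 := abs_sub_round ((k : ℝ) * Q / S)
  have r2 := abs_sub_round ((k' : ℝ) * Q / S)
  rw [h] at r1
  have := abs_sub_le ((k : ℝ) * Q / S) (round ((k' : ℝ) * Q / S) : ℝ) ((k' : ℝ) * Q / S)
  rw [abs_sub_comm (round ((k' : ℝ) * Q / S) : ℝ)] at this
  linarith

end PeriodFinding

end Literature.Computability.Cryptography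

end
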